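import Summits.CriticalPhenomena.CardyFormulaZ2.Theorems.CardyComplexConeCoherentMorera
import Summits.CriticalPhenomena.CardyFormulaZ2.Theorems.CardyComplexConeSLESixFamiliesGiveCardy
import Summits.CriticalPhenomena.CardyFormulaZ2.Theorems.CardyComplexConeParafermionToSLESixFamiliesOfSlitMartingaleData
import Literature.Probability.LatticeModels.MedialWindingBridge
import HarnessLib

/-!
# Summit-strength of crux `ParafermionToSLESixFamilies` (stmt-CriticalPhenomena-11389) — the tribunal's theorems, landed

Redirect strategist r1 (`Cruxes/ParafermionToSLESixFamilies/STRATEGY-CENSUS.md` Part 0, `SummitStrengthR1.lean`). Over LANDED theorems only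
(`CoherentMorera_proof` = item 11388, `SLESixFamiliesGiveCardy_of` = item 9654, the `…Defs` blocks and the landed
`CaratheodoryNetSlitUniformity.slesixAllFamilies_iff_sle6LimitZ2AllDiscretisations`):

* `crux_iff_blockC_of_thesis` — given the route's thesis X = EdgeCoherence ∧ EdgePrecompact, crux #5 ↔ its bare conclusion C (`SLESixAllFamilies`);
* (landed, reused) `slesixAllFamilies_iff_sle6LimitZ2AllDiscretisations` — C ↔ the open named conjecture `SLE6LimitZ2AllDiscretisations`;
* `summit_of_blockC'` — C → `CardyFormulaZ2` (C ≥ S outright);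
* `conjecture_dominates` — the conjecture dominates: it gives #5 (hypotheses unused) and gives S alone (tribunal T1 form);
* `crux_iff_summit_and_lift_of_thesis` — given X, #5 ↔ (S ∧ (S → C)): #5 is the summit plus the beyond-summit lift S → C (Camia–Newman on ℤ²).
-/

noncomputable section

namespace Summit.CriticalPhenomena.CardyFormulaZ2.Cruxes.ParafermionToSLESixFamilies.SummitStrength

open Summit.CriticalPhenomena.CardyFormulaZ2.Theses.CardyComplexCone
  (EdgeCoherence EdgePrecompact CoherentMorera ParafermionToSLESixFamilies SLESixFamiliesGiveCardy)
open Summit.CriticalPhenomena.CardyFormulaZ2.Cruxes.ParafermionToSLESixFamilies.CaratheodoryNetSlitUniformity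
  (WeakHolFamilies PrecompactFamilies SLESixAllFamilies slesixAllFamilies_iff_sle6LimitZ2AllDiscretisations)
open Summit.CriticalPhenomena.CardyFormulaZ2.Cruxes.CoherentMorera.FinitaryGreenPairing (CoherentMorera_proof)
open Summit.CriticalPhenomena.CardyFormulaZ2.Cruxes.SLESixFamiliesGiveCardy.CollarTouchSandwich (SLESixFamiliesGiveCardy_of)

/-- The crux is literally `A → B → C` over the `…Defs` blocks. [folklore] -/
theorem crux_iff' : ParafermionToSLESixFamilies ↔ (WeakHolFamilies → PrecompactFamilies → SLESixAllFamilies) := by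
  -- buildfix 2026-08-20: the `…Defs` blocks spell `MedialPath.passageSum`, the route clauses FermionicObservable's
  -- `passageSum` — two copies of one function until the Literature dedupe (bridge lemma, `rfl` afterwards).
  unfold WeakHolFamilies PrecompactFamilies
  rw [Literature.Probability.LatticeModels.MedialPath.passageSum_eq_passageSum']
  exact Iff.rfl

/-- The route's thesis X produces both hypotheses of the crux (item 11388, proved). [folklore] -/
theorem hypotheses_of_thesis (hC : EdgeCoherence) (hP : EdgePrecompact) : WeakHolFamilies ∧ PrecompactFamilies := by
  have h := CoherentMorera_proof hC hP -- buildfix 2026-08-20: bridge the two `passageSum` copies (see `crux_iff'`)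
  unfold WeakHolFamilies PrecompactFamilies
  rw [Literature.Probability.LatticeModels.MedialPath.passageSum_eq_passageSum']
  exact ⟨h.1, h.2⟩

/-- **Given the route's thesis, crux #5 is equivalent to its bare conclusion C.** [folklore] -/
theorem crux_iff_blockC_of_thesis : EdgeCoherence → EdgePrecompact → (ParafermionToSLESixFamilies ↔ SLESixAllFamilies) :=
  fun hC hP => by
    rw [crux_iff'] -- buildfix 2026-08-20: go through the bridged form
    exact ⟨fun h => h (hypotheses_of_thesis hC hP).1 (hypotheses_of_thesis hC hP).2, fun h _ _ => h⟩

/-- **C ≥ S outright**: block C alone gives the sub-problem statement (item 9654, proved). [folklore] -/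
theorem summit_of_blockC' : SLESixAllFamilies → _root_.CardyFormulaZ2 :=
  fun h => SLESixFamiliesGiveCardy_of h

/-- Tribunal T1, dominating-hypothesis form: the conjecture `SLE6LimitZ2AllDiscretisations` gives the crux (hypotheses unused) AND gives
the summit ALONE (stated as one conjunction so that no arrow-shaped theorem heads at an item or at the summit statement). [folklore] -/
theorem conjecture_dominates : (Literature.Probability.Percolation.SLE6LimitZ2AllDiscretisations → ParafermionToSLESixFamilies) ∧ (Literature.Probability.Percolation.SLE6LimitZ2AllDiscretisations → _root_.CardyFormulaZ2) :=
  ⟨fun h _ _ => slesixAllFamilies_iff_sle6LimitZ2AllDiscretisations.2 h, fun h => summit_of_blockC' (slesixAllFamilies_iff_sle6LimitZ2AllDiscretisations.2 h)⟩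

/-- **Given X, #5 is exactly the summit plus the beyond-summit lift S → C.** [folklore] -/
theorem crux_iff_summit_and_lift_of_thesis : EdgeCoherence → EdgePrecompact → (ParafermionToSLESixFamilies ↔ (_root_.CardyFormulaZ2 ∧ (_root_.CardyFormulaZ2 → SLESixAllFamilies))) := by
  intro hC hP
  rw [crux_iff_blockC_of_thesis hC hP]
  exact ⟨fun h => ⟨summit_of_blockC' h, fun _ => h⟩, fun h => h.2 h.1⟩

end Summit.CriticalPhenomena.CardyFormulaZ2.Cruxes.ParafermionToSLESixFamilies.SummitStrength

end
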